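import Literature.MathematicalPhysics.QuantumFieldTheory.Balaban1983to89.B9Thm37GlueTorusRW

/-!
# `Balaban1983to89.B9Thm37GlueTorusScaled` — the FULL inverse directly (Ω₀ ≡ the whole torus) and the lattice
# scaling c₀ = η⁻¹, q ≥ a₀η⁻²: explicit, η-UNIFORM (3.42)-shaped decay of G, ∇_UG, G∇\*_U, Δ_UG in the massive
# one-scale ℓ¹ torus model, and the pv21 chain's capstone `thm37_entry1_l1_rw` with ALL binders discharged;
# sibling leaf of `B9Thm37GlueTorusRW` (own lineage pv21; imports `B9Thm37GlueTorusRW` only; modifies nothing)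

References (bib keys; the tags below cite only these):
* [B9] = `Balaban1985BackgroundPropagators` — T. Bałaban, *Propagators for lattice gauge theories in a background
  field*, Commun. Math. Phys. 99 (1985) 389–434.
* [4] = `Balaban1984PropagatorsII` — T. Bałaban, *Propagators and renormalization transformations for lattice gauge
  theories. II*, Commun. Math. Phys. 96 (1984) 223–250.

THE PRINTED LOCI.  Only loci already certified in the headers of modules in this file's import closure are referred
to, and only as CONTEXT: [B9] (3.3) pp. 390–391 (the covariant derivative in components; `B9Thm37Glue`), (3.8) p. 392
and (3.23) p. 394 (Δ_U = D\*D; `B9Thm37Glue`), p. 394 (G′ = the inverse of the Dirichlet operator Ω₀Δ′_aΩ₀;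
`B9Thm37GlueTorusInv`), (3.42) p. 397 (the printed shape of the four entries; `B6RandomWalkHom` / `B9Thm37Glue`),
Corollary 3.6 p. 409 and Theorem 3.7 (3.87)–(3.90) pp. 408–410 (`B9Thm37Glue`); [4] (2.46) p. 231, (2.51) p. 232
(block majorants; `B6RandomWalk`).  No statement of this file quotes print; every declaration below is a MODEL
definition or a kernel-checked theorem about the one-scale model of the lineage, tagged [folklore].

THE POINT (value = kernel-checked certificate; the prose paragraph "NON-VACUITY / SCALING" of `B9Thm37GlueTorusRW`
made into THEOREMS; NOT summit progress).  `B9Thm37GlueTorusRW` proved the Corollary-3.6-shaped inputs `h342_1` …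
`h342_4` of the lineage for the Dirichlet local inverses G′_□ = `dirInv (Δ_U + M_q) Ω₀(□)` in the massive regime
q ≥ q_min > 0, for EVERY admissible ({0,1}-valued) cut-off family, and the capstones `thm37_entryn_l1_rw` (print's
local route (3.87)–(3.90): local inverses + partition of unity ⇒ (3.42) for the full inverse) modulo compatibility,
`hRm`, ranges, `hsmall`, `hre`, `hB1` … `hB4`, `hχ01`, `hχ`.  THIS FILE adds three things.
 (A) §1–§2, THE FULL INVERSE DIRECTLY.  The cut-off Ω₀ ≡ 1 (Dirichlet domain = the whole finite torus) is admissible,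
   and for it the Dirichlet local inverse IS the full inverse: `dirInv A 1 = Ring.inverse A` (`dirInv_const_one` —
   two lines of operator algebra: multiplication by 1 is the identity, by 1 − 1 the zero map).  Hence `h342_n_rw`
   at χ ≡ 1 gives the four (3.42)-shaped block bounds for G = (Δ_U + M_q)⁻¹, ∇_UG, G∇\*_U, Δ_UG DIRECTLY
   (`inverse_entry1_direct` … `inverse_entry4_direct`): UNDEGRADED rate δ₀ (any δ₀ with r = 2dc₀²/(2dc₀² + q_min) ≤
   e^{−δ₀}), constants exactly `hB1` … `hB4`, and NO compatibility / M₀ / `hsmall` / cover hypothesis at all.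
 (B) §3–§4, THE SCALING.  With c₀ = η⁻¹ (the η⁻¹ of the lattice covariant derivative, cf. (3.3)) and q ≥ a₀η⁻²
   (a site weight of the size of the cutoff; a₀ > 0 fixed), the rate is r = 2d/(2d + a₀) (`rwRate_scale` of
   `B9Thm37GlueTorusRW`; η-free), and the four constant inequalities hold with the ONE η-free constant
   C = `unifC d Cp a₀ δ` = (2d+1)√|Cp|(1+e^{δ})/a₀ (`hB1_scaled` … `hB4_scaled`; the scaling identities
   `scale_pow_zero|one|two`).  So, EXPLICITLY (`inverse_entry1_scaled` … `inverse_entry4_scaled`): for every δ with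
   2d/(2d + a₀) ≤ e^{−δ} (δ ≥ 0 for entries 2–4), EVERY torus, EVERY η > 0, every L, M, R, H, every orthogonal
   transport Rm and every q ≥ a₀η⁻²:  G-blocks ≤ Cη²e^{−δd₁}, ∇_UG-blocks ≤ Cηe^{−δd₁}, G∇\*_U-blocks ≤ Cηe^{−δd₁},
   Δ_UG-blocks ≤ Ce^{−δd₁} (d₁ = `tdist1`, the ℓ¹ torus distance in lattice units); and the EXISTENCE FORM
   `inverse_decay_uniform`: ∀ a₀ > 0 ∃ δ > 0 ∃ C ≥ 0 ∀ N ∀ η > 0 ∀ L M R H Rm (orthogonal) ∀ q ≥ a₀η⁻², all four —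
   the η-uniformity as QUANTIFIER ORDER (δ, C before N, η), with no inequality hypothesis left.
 (C) §5, THE CHAIN EXERCISED.  `thm37_entry1_l1_rw_uniform`: ∀ a₀ > 0 ∃ δ > 0 ∃ C ≥ 0 ∃ M₁ ∀ M₀ ≥ M₁ ∀ compatible
   torus (M₀ ∣ N_i, 2M₀ ≤ N_i) ∀ η > 0 ∀ L M R H Rm (orthogonal) ∀ q ≥ a₀η⁻²: G-blocks ≤ Cη²e^{−δd₁}, whose PROOF TERM
   is the capstone `thm37_entry1_l1_rw` (print's local route) applied with c₀ = η⁻¹, B₀ = `unifC`, α = 1/2, ρ = 1,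
   q_min = a₀η⁻², Ω₀(□) = `ballCut` (the indicator of the (M₀+1)-ball round the centre of □), its located smallness
   `hsmall` discharged by the η-FREE bound  hsmall's left side ≤ `chainK`/M₀ < 1/2 for M₀ ≥ M₁ := ⌈2·`chainK`⌉₊ + 1
   (`chainK` = 7^d·C·e^{δ}·((d + d|Cp|)·4d(2⌊1⌋₊+1)^d + 52d)·c₁(d, δ, 1/2)), `hre`, `hB1`, `hB2` by §3 with the SAME
   C, and the rate simplified by (1 − S)⁻¹ ≤ 2 (`rate_mono_aux`, `hasMajorant_mono`).  I.e. the binder family of the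
   capstone is JOINTLY satisfiable, uniformly in η, on every compatible torus with M₀ large — the non-vacuity of the
   pv21 chain `B9Thm37GlueTorus → …E123 → …Inv → …RW` as a theorem rather than a remark.  As a BOUND, (C) is weaker
   than (B) (halved rate, threshold M₁); its content is the consistency of the local route.  NOT DONE HERE: the same
   repackaging of `thm37_entry2_l1_rw` / `thm37_entry4_l1_rw` (binder family = entry 1's plus `hB4`) and of
   `thm37_entry3_l1_rw` ((1 + |Cp|) for (d + d|Cp|) in `hsmall`, `hB3`, 2α ≤ 1) — routine repetition; their extra
   binders are discharged individually, with the same C and δ, by `hB3_scaled`, `hB4_scaled`.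

HONEST REMARKS.  (i) THE REGIME IS THE TRIVIAL ONE.  d₁ is measured in lattice units, so e^{−δd₁} = e^{−δ|x−y|₁/η}:
a mass of the order of the cutoff (q ≥ a₀η⁻²) makes the propagator local ON THE SCALE OF THE LATTICE SPACING, and the
powers η², η, η, 1 are dimensional counting.  This is NOT the content of print's Theorems 3.1–3.3 / Corollary 3.6,
whose operators Δ_U + a(L^jη)⁻²Q′\*Q′ are massless apart from the averaging term and decay on the unit (block) scale;
the model's M_q with q ≥ a₀η⁻² is a MODEL stand-in, not print's Q′\*aQ′ (which has a large kernel as a site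
operator).  (ii) In the massive model the maximum principle of `B9Thm37GlueTorusRW` §5 holds on the whole finite
torus, so print's resummation over local inverses is not NEEDED to bound G — (A)/(B) are the sharper statements;
(C) keeps the local route's purpose: a certificate that the lineage's Theorem-3.7 bookkeeping is consistent with a
family of inputs that actually exists.  (iii) Nearest in-tree results of the kind (cited for orientation, NOT
imported, different models): `Beta.TorusG0Decay` (scalar, U ≡ 1, the massless −Δ^η + aQ\*Q, L² set-to-set decay on
the unit scale by Combes–Thomas + block Poincaré) and `Beta.FibreInverseDecay` (ℤ^d multipliers, Paley–Wiener).
(iv) `hRm` (Σ_k Rm(b)_{ki}Rm(b)_{kj} = δ_{ij}) stays a hypothesis, as in `B9Thm37GlueTorusRW`.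

NOT ASSERTED.  Print's Corollary 3.6, Theorems 3.1–3.3 and Theorem 3.7 themselves; the massless / multiscale regime;
scales j ≥ 1; print's constants or rates; that this file's method is print's; anything about the summit.  The file
certifies exactly: in the one-scale massive model with the lattice scaling, the (3.42)-shaped bounds for the full
inverse are explicit η-uniform THEOREMS, and the lineage's capstone has a jointly satisfiable hypothesis family.
-/

namespace Literature.MathematicalPhysics.QuantumFieldTheory.Balaban1983to89.B9Thm37GlueTorusScaled

open Finset B6RandomWalk B6RandomWalkHom B9Thm37Sum B9Thm34Ext B9Thm37Glue B9Thm37GlueT B9Thm37GlueSt B9Thm37GlueSz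
open B9Thm37GluePU B9Thm37GlueChart B9Thm37GlueTorus B9Thm37GlueTorusE123 B9Thm37GlueTorusInv B9Thm37GlueTorusRW
open B5TorusCover (UT Ctr ctrU)

noncomputable section

/-! ## §1  Ω₀ = the whole lattice: `dirInv A 1 = A⁻¹` -/

section WholeDomain

variable {X : Type}

/-- Multiplication by the constant function 1 is the identity operator. [folklore] -/
theorem mulOp_const_one : mulOp (fun _ : X => (1 : ℝ)) = 1 := by
  apply LinearMap.ext
  intro f
  funext x
  simp [mulOp_apply]

/-- Multiplication by `1 − 1 = 0` is the zero operator. [folklore] -/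
theorem mulOp_one_sub_const_one : mulOp ((1 : X → ℝ) - fun _ : X => (1 : ℝ)) = 0 := by
  apply LinearMap.ext
  intro f
  funext x
  simp [mulOp_apply]

/-- MODEL bookkeeping. For the cut-off Ω₀ ≡ 1 (the Dirichlet domain is the whole finite lattice) the Dirichlet
local inverse `dirInv A Ω₀ = Ω₀ (Ω₀ A Ω₀ + (1 − Ω₀))⁻¹ Ω₀` IS the full inverse `A⁻¹ = Ring.inverse A`. [folklore] -/
theorem dirInv_const_one (A : Module.End ℝ (X → ℝ)) : dirInv A (fun _ : X => (1 : ℝ)) = Ring.inverse A := by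
  simp only [dirInv, mulOp_const_one, mulOp_one_sub_const_one, one_mul, mul_one, add_zero]

/-- The same for any cut-off that is identically 1. [folklore] -/
theorem dirInv_of_forall_one (A : Module.End ℝ (X → ℝ)) {χ : X → ℝ} (h : ∀ x, χ x = 1) :
    dirInv A χ = Ring.inverse A := by
  have hχ : χ = fun _ : X => (1 : ℝ) := funext h
  subst hχ
  exact dirInv_const_one A

end WholeDomain

/-! ## §2  DIRECT decay of the full inverse in the massive one-scale model (sharp rate, no cover) -/

section Direct

variable {d : ℕ} {N : Fin d → ℕ} [∀ i, NeZero (N i)] {Cp : Type} [Fintype Cp] [DecidableEq Cp]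

/-- MODEL theorem (massive one-scale ℓ¹ torus model; NOT print's Theorem 3.1 / Corollary 3.6). **Entry 1 of (3.42)
for the FULL inverse G = (Δ_U + M_q)⁻¹, directly**: `h342_1_rw` applied to the admissible Dirichlet domain
Ω₀ = the whole torus (χ ≡ 1), where `dirInv (Δ_U + M_q) 1 = Ring.inverse (Δ_U + M_q)` (`dirInv_const_one`):
|G(x,·;y,·)|-blocks ≤ B₀ η² e^{−δ₀ d₁(x,y)} with the UNDEGRADED rate δ₀ of `hre` and NO compatibility / M₀ / hsmall
hypothesis — hypotheses: orthogonal R(U(b)) (`hRm`), q ≥ q_min > 0, r = 2dc₀²/(2dc₀² + q_min) ≤ e^{−δ₀},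
√|Cp|/q_min ≤ B₀η².  HONEST REMARK: in the massive model the maximum principle of `B9Thm37GlueTorusRW` §5 applies on
the whole (finite) torus, so print's resummation (3.87)–(3.90) over local inverses is not NEEDED to bound the full
inverse; the chain's capstones `thm37_entryn_l1_rw` keep their purpose as the certificate that print's LOCAL route
(local inverses + partition of unity ⇒ (3.42)) is consistent and non-vacuous in the model (§5 below).  For print's
massless multiscale operators no global maximum principle of this kind is available. [folklore] -/
theorem inverse_entry1_direct (η L M R : ℝ) (H : Prop) (c₀ : ℝ) (Rm : UT N × Fin d → Cp → Cp → ℝ)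
    (hRm : ∀ b i j, ∑ k, Rm b k i * Rm b k j = if i = j then 1 else 0) (q : UT N × Cp → ℝ) {qmin : ℝ}
    (hqmin : 0 < qmin) (hq : ∀ p, qmin ≤ q p) {δ₀ B₀ : ℝ} (hre : rwRate d c₀ qmin ≤ Real.exp (-δ₀))
    (hB : Real.sqrt (Fintype.card Cp) / qmin ≤ B₀ * η ^ 2) :
    HasMajorant (g := toB6 (torusGeom N η L M) R H) (cblk (chart0 N η L M))
      (Ring.inverse (covDT bsrc btgt (fun _ : UT N × Fin d => c₀) Rm ∘ₗ
          covD bsrc btgt (fun _ : UT N × Fin d => c₀) Rm + mulOp q))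
      (fun a b => B₀ * η ^ 2 * Real.exp (-(δ₀ * tdist1 N a b))) := by
  have hh := h342_1_rw η L M R H c₀ Rm hRm q hqmin hq hre hB (ι := Unit) (χ := fun _ _ => (1 : ℝ))
    (fun _ _ => Or.inr rfl) ()
  rw [dirInv_of_forall_one _ (χ := (fun _ : UT N => (1 : ℝ)) ∘ Prod.fst) (fun _ => rfl)] at hh
  exact hh

/-- MODEL theorem. **Entry 2 of (3.42) for ∇_U G, G the FULL inverse, directly** (`h342_2_rw` at Ω₀ ≡ 1):
blocks of ∇_U (Δ_U + M_q)⁻¹ ≤ B₀ η e^{−δ₀ d₁}, given |c₀|√|Cp|(1 + e^{δ₀})/q_min ≤ B₀η; no compatibility / M₀ /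
hsmall hypothesis, undegraded rate. [folklore] -/
theorem inverse_entry2_direct (η L M R : ℝ) (H : Prop) (c₀ : ℝ) (Rm : UT N × Fin d → Cp → Cp → ℝ)
    (hRm : ∀ b i j, ∑ k, Rm b k i * Rm b k j = if i = j then 1 else 0) (q : UT N × Cp → ℝ) {qmin : ℝ}
    (hqmin : 0 < qmin) (hq : ∀ p, qmin ≤ q p) {δ₀ B₀ : ℝ} (hδ₀ : 0 ≤ δ₀)
    (hre : rwRate d c₀ qmin ≤ Real.exp (-δ₀))
    (hB : |c₀| * Real.sqrt (Fintype.card Cp) * (1 + Real.exp δ₀) / qmin ≤ B₀ * η) :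
    HasMajorantHom (g := toB6 (torusGeom N η L M) R H) (cblk (chart0 N η L M)) (cblkY (chart0 N η L M))
      (covD bsrc btgt (fun _ : UT N × Fin d => c₀) Rm ∘ₗ
        Ring.inverse (covDT bsrc btgt (fun _ : UT N × Fin d => c₀) Rm ∘ₗ
          covD bsrc btgt (fun _ : UT N × Fin d => c₀) Rm + mulOp q))
      (fun a b => B₀ * η * Real.exp (-(δ₀ * tdist1 N a b))) := by
  have hh := h342_2_rw η L M R H c₀ Rm hRm q hqmin hq hδ₀ hre hB (ι := Unit) (χ := fun _ _ => (1 : ℝ))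
    (fun _ _ => Or.inr rfl) ()
  rw [dirInv_of_forall_one _ (χ := (fun _ : UT N => (1 : ℝ)) ∘ Prod.fst) (fun _ => rfl)] at hh
  exact hh

/-- MODEL theorem. **Entry 3 of (3.42) for G ∇*_U, G the FULL inverse, directly** (`h342_3_rw` at Ω₀ ≡ 1):
blocks of (Δ_U + M_q)⁻¹ ∇*_U ≤ B₀ η e^{−δ₀ d₁}, given d|c₀|√|Cp|(1 + e^{δ₀})/q_min ≤ B₀η. [folklore] -/
theorem inverse_entry3_direct (η L M R : ℝ) (H : Prop) (c₀ : ℝ) (Rm : UT N × Fin d → Cp → Cp → ℝ)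
    (hRm : ∀ b i j, ∑ k, Rm b k i * Rm b k j = if i = j then 1 else 0) (q : UT N × Cp → ℝ) {qmin : ℝ}
    (hqmin : 0 < qmin) (hq : ∀ p, qmin ≤ q p) {δ₀ B₀ : ℝ} (hδ₀ : 0 ≤ δ₀)
    (hre : rwRate d c₀ qmin ≤ Real.exp (-δ₀))
    (hB : d * |c₀| * Real.sqrt (Fintype.card Cp) * (1 + Real.exp δ₀) / qmin ≤ B₀ * η) :
    HasMajorantHom (g := toB6 (torusGeom N η L M) R H) (cblkY (chart0 N η L M)) (cblk (chart0 N η L M))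
      (Ring.inverse (covDT bsrc btgt (fun _ : UT N × Fin d => c₀) Rm ∘ₗ
          covD bsrc btgt (fun _ : UT N × Fin d => c₀) Rm + mulOp q) ∘ₗ
        covDT bsrc btgt (fun _ : UT N × Fin d => c₀) Rm)
      (fun a b => B₀ * η * Real.exp (-(δ₀ * tdist1 N a b))) := by
  have hh := h342_3_rw η L M R H c₀ Rm hRm q hqmin hq hδ₀ hre hB (ι := Unit) (χ := fun _ _ => (1 : ℝ))
    (fun _ _ => Or.inr rfl) ()
  rw [dirInv_of_forall_one _ (χ := (fun _ : UT N => (1 : ℝ)) ∘ Prod.fst) (fun _ => rfl)] at hh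
  exact hh

/-- MODEL theorem. **Entry 4 of (3.42) for Δ_U G, G the FULL inverse, directly** (`h342_4_rw` at Ω₀ ≡ 1):
blocks of Δ_U (Δ_U + M_q)⁻¹ ≤ B₀ e^{−δ₀ d₁}, given 2dc₀²√|Cp|(1 + e^{δ₀})/q_min ≤ B₀. [folklore] -/
theorem inverse_entry4_direct (η L M R : ℝ) (H : Prop) (c₀ : ℝ) (Rm : UT N × Fin d → Cp → Cp → ℝ)
    (hRm : ∀ b i j, ∑ k, Rm b k i * Rm b k j = if i = j then 1 else 0) (q : UT N × Cp → ℝ) {qmin : ℝ}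
    (hqmin : 0 < qmin) (hq : ∀ p, qmin ≤ q p) {δ₀ B₀ : ℝ} (hδ₀ : 0 ≤ δ₀)
    (hre : rwRate d c₀ qmin ≤ Real.exp (-δ₀))
    (hB : 2 * d * c₀ ^ 2 * Real.sqrt (Fintype.card Cp) * (1 + Real.exp δ₀) / qmin ≤ B₀) :
    HasMajorantHom (g := toB6 (torusGeom N η L M) R H) (cblk (chart0 N η L M)) (cblk (chart0 N η L M))
      ((covDT bsrc btgt (fun _ : UT N × Fin d => c₀) Rm ∘ₗ covD bsrc btgt (fun _ : UT N × Fin d => c₀) Rm) ∘ₗ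
        Ring.inverse (covDT bsrc btgt (fun _ : UT N × Fin d => c₀) Rm ∘ₗ
          covD bsrc btgt (fun _ : UT N × Fin d => c₀) Rm + mulOp q))
      (fun a b => B₀ * Real.exp (-(δ₀ * tdist1 N a b))) := by
  have hh := h342_4_rw η L M R H c₀ Rm hRm q hqmin hq hδ₀ hre hB (ι := Unit) (χ := fun _ _ => (1 : ℝ))
    (fun _ _ => Or.inr rfl) ()
  rw [dirInv_of_forall_one _ (χ := (fun _ : UT N => (1 : ℝ)) ∘ Prod.fst) (fun _ => rfl)] at hh
  exact hh

end Direct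

/-! ## §3  The lattice scaling c₀ = η⁻¹, q ≥ a₀η⁻²: η-free constants -/

section Scaling

variable {Cp : Type} [Fintype Cp]

/-- MODEL bookkeeping: the η-uniform constant of the scaled model, `C(d, |Cp|, a₀, δ) = (2d+1)√|Cp|(1+e^{δ})/a₀`.
[folklore] -/
def unifC (d : ℕ) (Cp : Type) [Fintype Cp] (a₀ δ : ℝ) : ℝ :=
  (2 * d + 1) * Real.sqrt (Fintype.card Cp) * (1 + Real.exp δ) / a₀

/-- `0 ≤ C` (a₀ > 0). [folklore] -/
theorem unifC_nonneg (d : ℕ) {a₀ : ℝ} (ha₀ : 0 < a₀) (δ : ℝ) : 0 ≤ unifC d Cp a₀ δ := by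
  unfold unifC
  positivity

/-- `X/a₀ ≤ C` for every `X ≤ (2d+1)√|Cp|(1+e^δ)`. [folklore] -/
theorem div_le_unifC (d : ℕ) {a₀ : ℝ} (ha₀ : 0 < a₀) (δ : ℝ) {X : ℝ}
    (hX : X ≤ (2 * d + 1) * Real.sqrt (Fintype.card Cp) * (1 + Real.exp δ)) : X / a₀ ≤ unifC d Cp a₀ δ := by
  unfold unifC
  rw [div_eq_mul_inv, div_eq_mul_inv]
  exact mul_le_mul_of_nonneg_right hX (inv_nonneg.mpr ha₀.le)

/-- `1 ≤ (2d+1)(1+e^δ)`. [folklore] -/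
theorem one_le_two_d_add_one_mul (d : ℕ) (δ : ℝ) : (1 : ℝ) ≤ (2 * d + 1) * (1 + Real.exp δ) := by
  have h1 : (1 : ℝ) ≤ 2 * d + 1 := by
    have : (0 : ℝ) ≤ d := Nat.cast_nonneg d
    linarith
  have h2 : (1 : ℝ) ≤ 1 + Real.exp δ := by linarith [Real.exp_pos δ]
  exact one_le_mul_of_one_le_of_one_le h1 h2

/-- hB1's constant: √|Cp| ≤ (2d+1)√|Cp|(1+e^δ). [folklore] -/
theorem sqrt_card_le (d : ℕ) (δ : ℝ) :
    Real.sqrt (Fintype.card Cp) ≤ (2 * d + 1) * Real.sqrt (Fintype.card Cp) * (1 + Real.exp δ) := by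
  have hs : 0 ≤ Real.sqrt (Fintype.card Cp) := Real.sqrt_nonneg _
  calc Real.sqrt (Fintype.card Cp) = Real.sqrt (Fintype.card Cp) * 1 := (mul_one _).symm
    _ ≤ Real.sqrt (Fintype.card Cp) * ((2 * d + 1) * (1 + Real.exp δ)) :=
        mul_le_mul_of_nonneg_left (one_le_two_d_add_one_mul d δ) hs
    _ = (2 * d + 1) * Real.sqrt (Fintype.card Cp) * (1 + Real.exp δ) := by ring

/-- hB2's / hB3's / hB4's constants: k√|Cp|(1+e^δ) ≤ (2d+1)√|Cp|(1+e^δ) for k ≤ 2d+1. [folklore] -/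
theorem coeff_sqrt_card_le (d : ℕ) (δ : ℝ) {k : ℝ} (hk : k ≤ 2 * d + 1) :
    k * Real.sqrt (Fintype.card Cp) * (1 + Real.exp δ) ≤
      (2 * d + 1) * Real.sqrt (Fintype.card Cp) * (1 + Real.exp δ) := by
  have hs : 0 ≤ Real.sqrt (Fintype.card Cp) := Real.sqrt_nonneg _
  have he : 0 ≤ 1 + Real.exp δ := by linarith [Real.exp_pos δ]
  exact mul_le_mul_of_nonneg_right (mul_le_mul_of_nonneg_right hk hs) he

/-- Scaling identity (entry 1): X/(a₀η⁻²) = (X/a₀)η² for η ≠ 0, a₀ ≠ 0. [folklore] -/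
theorem scale_pow_zero {η a₀ : ℝ} (hη : η ≠ 0) (ha₀ : a₀ ≠ 0) (X : ℝ) :
    X / (a₀ * η⁻¹ ^ 2) = X / a₀ * η ^ 2 := by
  field_simp

/-- Scaling identity (entries 2, 3): η⁻¹X/(a₀η⁻²) = (X/a₀)η. [folklore] -/
theorem scale_pow_one {η a₀ : ℝ} (hη : η ≠ 0) (ha₀ : a₀ ≠ 0) (X : ℝ) :
    η⁻¹ * X / (a₀ * η⁻¹ ^ 2) = X / a₀ * η := by
  field_simp

/-- Scaling identity (entry 4): η⁻²X/(a₀η⁻²) = X/a₀. [folklore] -/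
theorem scale_pow_two {η a₀ : ℝ} (hη : η ≠ 0) (ha₀ : a₀ ≠ 0) (X : ℝ) :
    η⁻¹ ^ 2 * X / (a₀ * η⁻¹ ^ 2) = X / a₀ := by
  field_simp

/-- hB1 of the chain in the scaled model: √|Cp|/(a₀η⁻²) ≤ C η². [folklore] -/
theorem hB1_scaled (d : ℕ) {a₀ : ℝ} (ha₀ : 0 < a₀) (δ : ℝ) {η : ℝ} (hη : 0 < η) :
    Real.sqrt (Fintype.card Cp) / (a₀ * η⁻¹ ^ 2) ≤ unifC d Cp a₀ δ * η ^ 2 := by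
  rw [scale_pow_zero hη.ne' ha₀.ne']
  exact mul_le_mul_of_nonneg_right (div_le_unifC d ha₀ δ (sqrt_card_le d δ)) (sq_nonneg η)

/-- hB2 of the chain in the scaled model: |η⁻¹|√|Cp|(1+e^δ)/(a₀η⁻²) ≤ C η. [folklore] -/
theorem hB2_scaled (d : ℕ) {a₀ : ℝ} (ha₀ : 0 < a₀) (δ : ℝ) {η : ℝ} (hη : 0 < η) :
    |η⁻¹| * Real.sqrt (Fintype.card Cp) * (1 + Real.exp δ) / (a₀ * η⁻¹ ^ 2) ≤ unifC d Cp a₀ δ * η := by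
  rw [abs_of_pos (inv_pos.mpr hη), mul_assoc, scale_pow_one hη.ne' ha₀.ne']
  refine mul_le_mul_of_nonneg_right (div_le_unifC d ha₀ δ ?_) hη.le
  have := coeff_sqrt_card_le (Cp := Cp) d δ (k := 1) (by have : (0:ℝ) ≤ d := Nat.cast_nonneg d; linarith)
  simpa using this

/-- hB3 of the chain in the scaled model: d|η⁻¹|√|Cp|(1+e^δ)/(a₀η⁻²) ≤ C η. [folklore] -/
theorem hB3_scaled (d : ℕ) {a₀ : ℝ} (ha₀ : 0 < a₀) (δ : ℝ) {η : ℝ} (hη : 0 < η) :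
    d * |η⁻¹| * Real.sqrt (Fintype.card Cp) * (1 + Real.exp δ) / (a₀ * η⁻¹ ^ 2) ≤ unifC d Cp a₀ δ * η := by
  rw [abs_of_pos (inv_pos.mpr hη)]
  have e : (d : ℝ) * η⁻¹ * Real.sqrt (Fintype.card Cp) * (1 + Real.exp δ) =
      η⁻¹ * ((d : ℝ) * Real.sqrt (Fintype.card Cp) * (1 + Real.exp δ)) := by ring
  rw [e, scale_pow_one hη.ne' ha₀.ne']
  refine mul_le_mul_of_nonneg_right (div_le_unifC d ha₀ δ ?_) hη.le
  exact coeff_sqrt_card_le d δ (by have : (0:ℝ) ≤ d := Nat.cast_nonneg d; linarith)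

/-- hB4 of the chain in the scaled model: 2dη⁻²√|Cp|(1+e^δ)/(a₀η⁻²) ≤ C. [folklore] -/
theorem hB4_scaled (d : ℕ) {a₀ : ℝ} (ha₀ : 0 < a₀) (δ : ℝ) {η : ℝ} (hη : 0 < η) :
    2 * d * η⁻¹ ^ 2 * Real.sqrt (Fintype.card Cp) * (1 + Real.exp δ) / (a₀ * η⁻¹ ^ 2) ≤ unifC d Cp a₀ δ := by
  have e : 2 * (d : ℝ) * η⁻¹ ^ 2 * Real.sqrt (Fintype.card Cp) * (1 + Real.exp δ) =
      η⁻¹ ^ 2 * (2 * (d : ℝ) * Real.sqrt (Fintype.card Cp) * (1 + Real.exp δ)) := by ring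
  rw [e, scale_pow_two hη.ne' ha₀.ne']
  exact div_le_unifC d ha₀ δ (coeff_sqrt_card_le d δ (by linarith))

/-- The rate condition of the scaled model in closed form: r = 2d/(2d + a₀) ≤ e^{−δ} is `hre` for EVERY η ≠ 0.
[folklore] -/
theorem hre_scaled (d : ℕ) {a₀ δ : ℝ} (hrate : 2 * d / (2 * d + a₀) ≤ Real.exp (-δ)) {η : ℝ} (hη : η ≠ 0) :
    rwRate d η⁻¹ (a₀ * η⁻¹ ^ 2) ≤ Real.exp (-δ) := by
  rw [rwRate_scale d hη]
  exact hrate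

/-- The closed-form rate condition is satisfiable with δ > 0 (a₀ > 0). [folklore] -/
theorem exists_closed_rate (d : ℕ) {a₀ : ℝ} (ha₀ : 0 < a₀) :
    ∃ δ : ℝ, 0 < δ ∧ 2 * d / (2 * d + a₀) ≤ Real.exp (-δ) := by
  obtain ⟨δ, hδ, h⟩ := exists_rate d (1 : ℝ)⁻¹ (qmin := a₀ * (1 : ℝ)⁻¹ ^ 2) (by simpa using ha₀)
  refine ⟨δ, hδ, ?_⟩
  rw [rwRate_scale d one_ne_zero] at h
  exact h

end Scaling

/-! ## §4  The scaled massive one-scale model: explicit η-uniform bounds and the existence theorem -/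

section Uniform

variable {d : ℕ} {N : Fin d → ℕ} [∀ i, NeZero (N i)] {Cp : Type} [Fintype Cp] [DecidableEq Cp]

/-- MODEL theorem (scaled massive one-scale model; NOT print's Theorem 3.1 / Cor. 3.6). **Entry 1, explicit and
η-uniform**: with c₀ = η⁻¹ (the scaling of (3.3)), q ≥ a₀η⁻², orthogonal R(U(b)), and ANY δ with
2d/(2d + a₀) ≤ e^{−δ} (an η-free condition): the blocks of G = (Δ_U + M_q)⁻¹ are ≤ C η² e^{−δ d₁},
C = `unifC d Cp a₀ δ` = (2d+1)√|Cp|(1+e^δ)/a₀ — for every torus, every η > 0, every L, M, R, H. [folklore] -/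
theorem inverse_entry1_scaled {a₀ : ℝ} (ha₀ : 0 < a₀) {δ : ℝ} (hrate : 2 * d / (2 * d + a₀) ≤ Real.exp (-δ))
    {η : ℝ} (hη : 0 < η) (L M R : ℝ) (H : Prop) (Rm : UT N × Fin d → Cp → Cp → ℝ)
    (hRm : ∀ b i j, ∑ k, Rm b k i * Rm b k j = if i = j then 1 else 0) (q : UT N × Cp → ℝ)
    (hq : ∀ p, a₀ * η⁻¹ ^ 2 ≤ q p) :
    HasMajorant (g := toB6 (torusGeom N η L M) R H) (cblk (chart0 N η L M))
      (Ring.inverse (covDT bsrc btgt (fun _ : UT N × Fin d => η⁻¹) Rm ∘ₗ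
          covD bsrc btgt (fun _ : UT N × Fin d => η⁻¹) Rm + mulOp q))
      (fun a b => unifC d Cp a₀ δ * η ^ 2 * Real.exp (-(δ * tdist1 N a b))) :=
  inverse_entry1_direct η L M R H η⁻¹ Rm hRm q (by positivity) hq (hre_scaled d hrate hη.ne')
    (hB1_scaled d ha₀ δ hη)

/-- MODEL theorem. **Entry 2, explicit and η-uniform** (scaled massive model): ∇_UG-blocks ≤ C η e^{−δ d₁} under the
same η-free condition on δ (δ ≥ 0). [folklore] -/
theorem inverse_entry2_scaled {a₀ : ℝ} (ha₀ : 0 < a₀) {δ : ℝ} (hδ : 0 ≤ δ)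
    (hrate : 2 * d / (2 * d + a₀) ≤ Real.exp (-δ))
    {η : ℝ} (hη : 0 < η) (L M R : ℝ) (H : Prop) (Rm : UT N × Fin d → Cp → Cp → ℝ)
    (hRm : ∀ b i j, ∑ k, Rm b k i * Rm b k j = if i = j then 1 else 0) (q : UT N × Cp → ℝ)
    (hq : ∀ p, a₀ * η⁻¹ ^ 2 ≤ q p) :
    HasMajorantHom (g := toB6 (torusGeom N η L M) R H) (cblk (chart0 N η L M)) (cblkY (chart0 N η L M))
      (covD bsrc btgt (fun _ : UT N × Fin d => η⁻¹) Rm ∘ₗ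
        Ring.inverse (covDT bsrc btgt (fun _ : UT N × Fin d => η⁻¹) Rm ∘ₗ
          covD bsrc btgt (fun _ : UT N × Fin d => η⁻¹) Rm + mulOp q))
      (fun a b => unifC d Cp a₀ δ * η * Real.exp (-(δ * tdist1 N a b))) :=
  inverse_entry2_direct η L M R H η⁻¹ Rm hRm q (by positivity) hq hδ (hre_scaled d hrate hη.ne')
    (hB2_scaled d ha₀ δ hη)

/-- MODEL theorem. **Entry 3, explicit and η-uniform** (scaled massive model): G∇*_U-blocks ≤ C η e^{−δ d₁}.
[folklore] -/
theorem inverse_entry3_scaled {a₀ : ℝ} (ha₀ : 0 < a₀) {δ : ℝ} (hδ : 0 ≤ δ)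
    (hrate : 2 * d / (2 * d + a₀) ≤ Real.exp (-δ))
    {η : ℝ} (hη : 0 < η) (L M R : ℝ) (H : Prop) (Rm : UT N × Fin d → Cp → Cp → ℝ)
    (hRm : ∀ b i j, ∑ k, Rm b k i * Rm b k j = if i = j then 1 else 0) (q : UT N × Cp → ℝ)
    (hq : ∀ p, a₀ * η⁻¹ ^ 2 ≤ q p) :
    HasMajorantHom (g := toB6 (torusGeom N η L M) R H) (cblkY (chart0 N η L M)) (cblk (chart0 N η L M))
      (Ring.inverse (covDT bsrc btgt (fun _ : UT N × Fin d => η⁻¹) Rm ∘ₗ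
          covD bsrc btgt (fun _ : UT N × Fin d => η⁻¹) Rm + mulOp q) ∘ₗ
        covDT bsrc btgt (fun _ : UT N × Fin d => η⁻¹) Rm)
      (fun a b => unifC d Cp a₀ δ * η * Real.exp (-(δ * tdist1 N a b))) :=
  inverse_entry3_direct η L M R H η⁻¹ Rm hRm q (by positivity) hq hδ (hre_scaled d hrate hη.ne')
    (hB3_scaled d ha₀ δ hη)

/-- MODEL theorem. **Entry 4, explicit and η-uniform** (scaled massive model): Δ_UG-blocks ≤ C e^{−δ d₁}.
[folklore] -/
theorem inverse_entry4_scaled {a₀ : ℝ} (ha₀ : 0 < a₀) {δ : ℝ} (hδ : 0 ≤ δ)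
    (hrate : 2 * d / (2 * d + a₀) ≤ Real.exp (-δ))
    {η : ℝ} (hη : 0 < η) (L M R : ℝ) (H : Prop) (Rm : UT N × Fin d → Cp → Cp → ℝ)
    (hRm : ∀ b i j, ∑ k, Rm b k i * Rm b k j = if i = j then 1 else 0) (q : UT N × Cp → ℝ)
    (hq : ∀ p, a₀ * η⁻¹ ^ 2 ≤ q p) :
    HasMajorantHom (g := toB6 (torusGeom N η L M) R H) (cblk (chart0 N η L M)) (cblk (chart0 N η L M))
      ((covDT bsrc btgt (fun _ : UT N × Fin d => η⁻¹) Rm ∘ₗ covD bsrc btgt (fun _ : UT N × Fin d => η⁻¹) Rm) ∘ₗ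
        Ring.inverse (covDT bsrc btgt (fun _ : UT N × Fin d => η⁻¹) Rm ∘ₗ
          covD bsrc btgt (fun _ : UT N × Fin d => η⁻¹) Rm + mulOp q))
      (fun a b => unifC d Cp a₀ δ * Real.exp (-(δ * tdist1 N a b))) :=
  inverse_entry4_direct η L M R H η⁻¹ Rm hRm q (by positivity) hq hδ (hre_scaled d hrate hη.ne')
    (hB4_scaled d ha₀ δ hη)

end Uniform

section UniformExists

variable {d : ℕ} {Cp : Type} [Fintype Cp] [DecidableEq Cp]

/-- MODEL theorem (massive one-scale ℓ¹ torus model with the LATTICE SCALING; NOT print's Theorem 3.1 / Cor. 3.6).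
**η-uniform off-diagonal decay of the full propagator and its covariant derivatives — existence form.**  With the
scaling of (3.3), ∇^η_U f(b) = η⁻¹(R(U(b))f(b₊) − f(b₋)) (c₀ = η⁻¹, orthogonal component matrices R(U(b)), `hRm`),
and a mass term M_q with q ≥ a₀η⁻² (the j = 0 mass scale aη⁻² of a(L^jη)⁻²Q′*Q′ with the averaging operator
REPLACED BY 1 — a MODEL stand-in, not print's operator): for every a₀ > 0 there are δ > 0 and C ≥ 0 depending on
d, |Cp| and a₀ ONLY such that for EVERY torus (N is quantified AFTER δ, C), EVERY lattice spacing η > 0, every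
L, M, R, H, every orthogonal transport Rm and every such q, the four (3.42)-type block majorants hold for
G = (Δ_U + M_q)⁻¹: G-blocks ≤ Cη²e^{−δd₁}, ∇_UG-blocks ≤ Cηe^{−δd₁}, G∇*_U-blocks ≤ Cηe^{−δd₁}, Δ_UG-blocks ≤ Ce^{−δd₁}
(d₁ = the ℓ¹ torus distance in lattice units).  NO inequality hypothesis is left: this is the theorem form of the
non-vacuity of the h342 family of the pv21 chain.  Constants: δ from `exists_closed_rate` (2d/(2d+a₀) ≤ e^{−δ}),
C = `unifC d Cp a₀ δ`.  Nothing printed is asserted; the massless regime, the multiscale operators and print's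
constants are NOT touched. [folklore] -/
theorem inverse_decay_uniform {a₀ : ℝ} (ha₀ : 0 < a₀) :
    ∃ δ : ℝ, 0 < δ ∧ ∃ C : ℝ, 0 ≤ C ∧
      ∀ (N : Fin d → ℕ) [∀ i, NeZero (N i)] (η : ℝ), 0 < η →
      ∀ (L M R : ℝ) (H : Prop) (Rm : UT N × Fin d → Cp → Cp → ℝ),
        (∀ b i j, ∑ k, Rm b k i * Rm b k j = if i = j then (1 : ℝ) else 0) →
      ∀ (q : UT N × Cp → ℝ), (∀ p, a₀ * η⁻¹ ^ 2 ≤ q p) →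
        HasMajorant (g := toB6 (torusGeom N η L M) R H) (cblk (chart0 N η L M))
          (Ring.inverse (covDT bsrc btgt (fun _ : UT N × Fin d => η⁻¹) Rm ∘ₗ
              covD bsrc btgt (fun _ : UT N × Fin d => η⁻¹) Rm + mulOp q))
          (fun a b => C * η ^ 2 * Real.exp (-(δ * tdist1 N a b))) ∧
        HasMajorantHom (g := toB6 (torusGeom N η L M) R H) (cblk (chart0 N η L M)) (cblkY (chart0 N η L M))
          (covD bsrc btgt (fun _ : UT N × Fin d => η⁻¹) Rm ∘ₗ
            Ring.inverse (covDT bsrc btgt (fun _ : UT N × Fin d => η⁻¹) Rm ∘ₗ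
              covD bsrc btgt (fun _ : UT N × Fin d => η⁻¹) Rm + mulOp q))
          (fun a b => C * η * Real.exp (-(δ * tdist1 N a b))) ∧
        HasMajorantHom (g := toB6 (torusGeom N η L M) R H) (cblkY (chart0 N η L M)) (cblk (chart0 N η L M))
          (Ring.inverse (covDT bsrc btgt (fun _ : UT N × Fin d => η⁻¹) Rm ∘ₗ
              covD bsrc btgt (fun _ : UT N × Fin d => η⁻¹) Rm + mulOp q) ∘ₗ
            covDT bsrc btgt (fun _ : UT N × Fin d => η⁻¹) Rm)
          (fun a b => C * η * Real.exp (-(δ * tdist1 N a b))) ∧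
        HasMajorantHom (g := toB6 (torusGeom N η L M) R H) (cblk (chart0 N η L M)) (cblk (chart0 N η L M))
          ((covDT bsrc btgt (fun _ : UT N × Fin d => η⁻¹) Rm ∘ₗ covD bsrc btgt (fun _ : UT N × Fin d => η⁻¹) Rm) ∘ₗ
            Ring.inverse (covDT bsrc btgt (fun _ : UT N × Fin d => η⁻¹) Rm ∘ₗ
              covD bsrc btgt (fun _ : UT N × Fin d => η⁻¹) Rm + mulOp q))
          (fun a b => C * Real.exp (-(δ * tdist1 N a b))) := by
  obtain ⟨δ, hδ, hrate⟩ := exists_closed_rate d ha₀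
  refine ⟨δ, hδ, unifC d Cp a₀ δ, unifC_nonneg d ha₀ δ, ?_⟩
  intro N _ η hη L M R H Rm hRm q hq
  exact ⟨inverse_entry1_scaled ha₀ hrate hη L M R H Rm hRm q hq,
    inverse_entry2_scaled ha₀ hδ.le hrate hη L M R H Rm hRm q hq,
    inverse_entry3_scaled ha₀ hδ.le hrate hη L M R H Rm hRm q hq,
    inverse_entry4_scaled ha₀ hδ.le hrate hη L M R H Rm hRm q hq⟩

end UniformExists

/-! ## §5  The CHAIN exercised: the capstone `thm37_entry1_l1_rw` has a jointly satisfiable binder family -/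

section Chain

variable {d : ℕ} {Cp : Type} [Fintype Cp]

/-- MODEL bookkeeping: the cut-offs Ω₀(□) := 1_{dist(·, centre of □) < M₀ + 1} — {0,1}-valued and equal to 1 on
the (M₀ + 1)-ball round the centre (print's Ω₀(□) ⊇ □̃, p. 408; here a MODEL choice). [folklore] -/
def ballCut {d : ℕ} (N : Fin d → ℕ) [∀ i, NeZero (N i)] (M₀ : ℕ) (i : Ctr N M₀) (x : UT N) : ℝ :=
  if dist x (ctrU N M₀ i) < M₀ + 1 then 1 else 0

/-- `ballCut` is {0,1}-valued (`hχ01` of the capstones). [folklore] -/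
theorem ballCut_zero_or_one {d : ℕ} (N : Fin d → ℕ) [∀ i, NeZero (N i)] (M₀ : ℕ) (i : Ctr N M₀) (x : UT N) :
    ballCut N M₀ i x = 0 ∨ ballCut N M₀ i x = 1 := by
  unfold ballCut
  split_ifs
  · exact Or.inr rfl
  · exact Or.inl rfl

/-- `ballCut` = 1 on the (M₀+1)-ball (`hχ` of the capstones). [folklore] -/
theorem ballCut_eq_one {d : ℕ} (N : Fin d → ℕ) [∀ i, NeZero (N i)] (M₀ : ℕ) (i : Ctr N M₀) (x : UT N)
    (h : dist x (ctrU N M₀ i) < M₀ + 1) : ballCut N M₀ i x = 1 := by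
  unfold ballCut
  rw [if_pos h]

/-- MODEL bookkeeping: the η-free numerator K(d, |Cp|, a₀, δ₀) of the smallness quantity `hsmall` of
`thm37_entry1_l1_rw` in the scaled model (c₀ = η⁻¹, B₀ = `unifC`, ρ = 1, α = 1/2): hsmall's left side is ≤ K/M₀.
[folklore] -/
def chainK (d : ℕ) (Cp : Type) [Fintype Cp] (a₀ δ₀ : ℝ) : ℝ :=
  (7 : ℝ) ^ d * (unifC d Cp a₀ δ₀ * Real.exp (δ₀ * 1) *
    ((d + d * Fintype.card Cp : ℝ) * (4 * d * (2 * ⌊(1 : ℝ)⌋₊ + 1 : ℝ) ^ d) + 52 * d)) * B6.c1 d δ₀ (1 / 2)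

/-- `0 ≤ K`. [folklore] -/
theorem chainK_nonneg (d : ℕ) {a₀ : ℝ} (ha₀ : 0 < a₀) (δ₀ : ℝ) : 0 ≤ chainK d Cp a₀ δ₀ := by
  unfold chainK
  have hU := unifC_nonneg (Cp := Cp) d ha₀ δ₀
  have hc1 := c1_nonneg d δ₀ (1 / 2)
  positivity

/-- The rate comparison used to simplify the capstone's rate: X(1 − S)⁻¹η²e^{−(1−1/2)δ₀t} ≤ 2Xη²e^{−(δ₀/2)t} for
S < 1/2, X ≥ 0. [folklore] -/
theorem rate_mono_aux {S δ₀ η t X : ℝ} (hX : 0 ≤ X) (hS : S < 1 / 2) :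
    X * (1 - S)⁻¹ * η ^ 2 * Real.exp (-((1 - 1 / 2) * δ₀ * t)) ≤ 2 * X * η ^ 2 * Real.exp (-(δ₀ / 2 * t)) := by
  have he : (1 - 1 / 2) * δ₀ * t = δ₀ / 2 * t := by ring
  rw [he]
  have hinv : (1 - S)⁻¹ ≤ 2 := by
    rw [inv_le_comm₀ (by linarith) (by norm_num)]
    linarith
  have hpos : 0 ≤ X * η ^ 2 * Real.exp (-(δ₀ / 2 * t)) := by positivity
  calc X * (1 - S)⁻¹ * η ^ 2 * Real.exp (-(δ₀ / 2 * t))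
        = (1 - S)⁻¹ * (X * η ^ 2 * Real.exp (-(δ₀ / 2 * t))) := by ring
    _ ≤ 2 * (X * η ^ 2 * Real.exp (-(δ₀ / 2 * t))) := mul_le_mul_of_nonneg_right hinv hpos
    _ = 2 * X * η ^ 2 * Real.exp (-(δ₀ / 2 * t)) := by ring

variable [DecidableEq Cp]

/-- MODEL theorem (the CHAIN EXERCISED; massive one-scale ℓ¹ torus model with the lattice scaling; NOT print's
Theorem 3.7).  **Entry 1 of (3.42) for G = (Δ_U + M_q)⁻¹ THROUGH the capstone `thm37_entry1_l1_rw`** — i.e. through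
print's route (3.87)–(3.90): Dirichlet local inverses G′_□ on Ω₀(□) = (M₀+1)-balls (`ballCut`), partition of unity
{h_□}, resummation — with EVERY binder of the capstone discharged: for every a₀ > 0 there are δ > 0, C ≥ 0 and a
threshold M₁ (depending on d, |Cp|, a₀ only) such that for every M₀ ≥ M₁, every compatible torus (M₀ ∣ N_i,
2M₀ ≤ N_i), every η > 0, every L, M, R, H, every orthogonal transport and every q ≥ a₀η⁻², the G-blocks are
≤ Cη²e^{−δd₁}.  The PROOF TERM is the certificate: `thm37_entry1_l1_rw` applied with c₀ = η⁻¹, B₀ = `unifC`, δ₀ from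
`exists_closed_rate`, α = 1/2, ρ = 1, q_min = a₀η⁻², χ_□ = `ballCut`, its `hsmall` discharged by `hsmall`'s left side
≤ `chainK`/M₀ < 1/2 (M₀ ≥ M₁ = ⌈2·chainK⌉₊ + 1), `hre`/`hB1`/`hB2` by §3, and the rate simplified by (1 − S)⁻¹ ≤ 2
(`rate_mono_aux`, `hasMajorant_mono`); so the capstone's binder family (compatibility apart) is JOINTLY SATISFIABLE,
uniformly in η — the non-vacuity of the pv21 chain as a theorem.  As a bound on G it is WEAKER than §4 (rate δ₀/2,
threshold M₁); its content is the consistency of the local route.  Nothing printed is asserted. [folklore] -/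
theorem thm37_entry1_l1_rw_uniform {a₀ : ℝ} (ha₀ : 0 < a₀) :
    ∃ δ : ℝ, 0 < δ ∧ ∃ C : ℝ, 0 ≤ C ∧ ∃ M₁ : ℕ, 1 ≤ M₁ ∧
      ∀ (N : Fin d → ℕ) [∀ i, NeZero (N i)] (M₀ : ℕ), M₁ ≤ M₀ → (∀ i, M₀ ∣ N i) → (∀ i, 2 * M₀ ≤ N i) →
      ∀ (η : ℝ), 0 < η → ∀ (L M R : ℝ) (H : Prop) (Rm : UT N × Fin d → Cp → Cp → ℝ),
        (∀ b i j, ∑ k, Rm b k i * Rm b k j = if i = j then (1 : ℝ) else 0) →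
      ∀ (q : UT N × Cp → ℝ), (∀ p, a₀ * η⁻¹ ^ 2 ≤ q p) →
        HasMajorant (g := toB6 (torusGeom N η L M) R H) (cblk (chart0 N η L M))
          (Ring.inverse (covDT bsrc btgt (fun _ : UT N × Fin d => η⁻¹) Rm ∘ₗ
              covD bsrc btgt (fun _ : UT N × Fin d => η⁻¹) Rm + mulOp q))
          (fun a b => C * η ^ 2 * Real.exp (-(δ * tdist1 N a b))) := by
  obtain ⟨δ₀, hδ₀, hrate⟩ := exists_closed_rate d ha₀
  have hU : 0 ≤ unifC d Cp a₀ δ₀ := unifC_nonneg d ha₀ δ₀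
  have hc1 : 0 ≤ B6.c1 d δ₀ (1 / 2) := c1_nonneg d δ₀ (1 / 2)
  have hK : 0 ≤ chainK d Cp a₀ δ₀ := chainK_nonneg d ha₀ δ₀
  have hX : 0 ≤ (5 : ℝ) ^ d * unifC d Cp a₀ δ₀ * B6.c1 d δ₀ (1 / 2) := by positivity
  refine ⟨δ₀ / 2, by positivity, 2 * ((5 : ℝ) ^ d * unifC d Cp a₀ δ₀ * B6.c1 d δ₀ (1 / 2)), by positivity,
    ⌈2 * chainK d Cp a₀ δ₀⌉₊ + 1, Nat.le_add_left 1 _, ?_⟩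
  intro N _ M₀ hM₁ hdiv h2N η hη L M R H Rm hRm q hq
  have hM : 1 ≤ M₀ := le_trans (Nat.le_add_left 1 _) hM₁
  have hM0 : (0 : ℝ) < M₀ := Nat.cast_pos.mpr hM
  have hM1r : (1 : ℝ) ≤ M₀ := by exact_mod_cast hM
  have h2K : 2 * chainK d Cp a₀ δ₀ < (M₀ : ℝ) := by
    have h1 : 2 * chainK d Cp a₀ δ₀ ≤ (⌈2 * chainK d Cp a₀ δ₀⌉₊ : ℝ) := Nat.le_ceil _
    have h2 : ((⌈2 * chainK d Cp a₀ δ₀⌉₊ + 1 : ℕ) : ℝ) ≤ M₀ := by exact_mod_cast hM₁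
    push_cast at h2
    linarith
  have hη0 : η ≠ 0 := hη.ne'
  have hqmin : 0 < a₀ * η⁻¹ ^ 2 := by positivity
  have hre := hre_scaled d hrate hη0
  have habs : |η⁻¹| = η⁻¹ := abs_of_pos (inv_pos.mpr hη)
  -- the smallness quantity of the capstone is η-free and ≤ K / M₀ < 1/2
  have h1 : |η⁻¹| * (4 * d / (M₀ : ℝ)) * ((2 * ⌊(1 : ℝ)⌋₊ + 1 : ℝ) ^ d * η) =
      4 * d * (2 * ⌊(1 : ℝ)⌋₊ + 1 : ℝ) ^ d / M₀ := by
    rw [habs]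
    have e : η⁻¹ * (4 * d / (M₀ : ℝ)) * ((2 * ⌊(1 : ℝ)⌋₊ + 1 : ℝ) ^ d * η) =
        η⁻¹ * η * (4 * d * (2 * ⌊(1 : ℝ)⌋₊ + 1 : ℝ) ^ d / M₀) := by ring
    rw [e, inv_mul_cancel₀ hη0, one_mul]
  have h2 : η⁻¹ ^ 2 * (52 * d / (M₀ : ℝ) ^ 2) * η ^ 2 = 52 * d / (M₀ : ℝ) ^ 2 := by
    have e : η⁻¹ ^ 2 * (52 * d / (M₀ : ℝ) ^ 2) * η ^ 2 = (η⁻¹ * η) ^ 2 * (52 * d / (M₀ : ℝ) ^ 2) := by ring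
    rw [e, inv_mul_cancel₀ hη0, one_pow, one_mul]
  have hS : (7 : ℝ) ^ d * (unifC d Cp a₀ δ₀ * Real.exp (δ₀ * 1) *
      ((d + d * Fintype.card Cp : ℝ) * (|η⁻¹| * (4 * d / (M₀ : ℝ)) * ((2 * ⌊(1 : ℝ)⌋₊ + 1 : ℝ) ^ d * η)) +
        η⁻¹ ^ 2 * (52 * d / (M₀ : ℝ) ^ 2) * η ^ 2)) * B6.c1 d δ₀ (1 / 2) ≤ chainK d Cp a₀ δ₀ / M₀ := by
    rw [h1, h2]
    have hsec : 52 * (d : ℝ) / (M₀ : ℝ) ^ 2 ≤ 52 * d / M₀ :=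
      div_le_div_of_nonneg_left (by positivity) hM0 (by nlinarith)
    have hinner : (d + d * Fintype.card Cp : ℝ) * (4 * d * (2 * ⌊(1 : ℝ)⌋₊ + 1 : ℝ) ^ d / M₀) +
        52 * d / (M₀ : ℝ) ^ 2 ≤
        ((d + d * Fintype.card Cp : ℝ) * (4 * d * (2 * ⌊(1 : ℝ)⌋₊ + 1 : ℝ) ^ d) + 52 * d) / M₀ := by
      rw [add_div, ← mul_div_assoc]
      exact add_le_add le_rfl hsec
    have hUe : 0 ≤ unifC d Cp a₀ δ₀ * Real.exp (δ₀ * 1) := by positivity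
    calc (7 : ℝ) ^ d * (unifC d Cp a₀ δ₀ * Real.exp (δ₀ * 1) *
          ((d + d * Fintype.card Cp : ℝ) * (4 * d * (2 * ⌊(1 : ℝ)⌋₊ + 1 : ℝ) ^ d / M₀) +
            52 * d / (M₀ : ℝ) ^ 2)) * B6.c1 d δ₀ (1 / 2)
          ≤ (7 : ℝ) ^ d * (unifC d Cp a₀ δ₀ * Real.exp (δ₀ * 1) *
          (((d + d * Fintype.card Cp : ℝ) * (4 * d * (2 * ⌊(1 : ℝ)⌋₊ + 1 : ℝ) ^ d) + 52 * d) / M₀)) *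
            B6.c1 d δ₀ (1 / 2) :=
          mul_le_mul_of_nonneg_right
            (mul_le_mul_of_nonneg_left (mul_le_mul_of_nonneg_left hinner hUe) (by positivity)) hc1
      _ = chainK d Cp a₀ δ₀ / M₀ := by
          unfold chainK
          ring
  have hKM : chainK d Cp a₀ δ₀ / M₀ < 1 / 2 := by
    rw [div_lt_iff₀ hM0]
    linarith
  have hSlt : (7 : ℝ) ^ d * (unifC d Cp a₀ δ₀ * Real.exp (δ₀ * 1) *
      ((d + d * Fintype.card Cp : ℝ) * (|η⁻¹| * (4 * d / (M₀ : ℝ)) * ((2 * ⌊(1 : ℝ)⌋₊ + 1 : ℝ) ^ d * η)) +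
        η⁻¹ ^ 2 * (52 * d / (M₀ : ℝ) ^ 2) * η ^ 2)) * B6.c1 d δ₀ (1 / 2) < 1 / 2 := lt_of_le_of_lt hS hKM
  have hsmall : (7 : ℝ) ^ d * (unifC d Cp a₀ δ₀ * Real.exp (δ₀ * 1) *
      ((d + d * Fintype.card Cp : ℝ) * (|η⁻¹| * (4 * d / (M₀ : ℝ)) * ((2 * ⌊(1 : ℝ)⌋₊ + 1 : ℝ) ^ d * η)) +
        η⁻¹ ^ 2 * (52 * d / (M₀ : ℝ) ^ 2) * η ^ 2)) * B6.c1 d δ₀ (1 / 2) < 1 := by linarith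
  -- the capstone, through print's local route
  have hcap := thm37_entry1_l1_rw (N := N) hM hdiv h2N η L M R H hη.le η⁻¹ Rm q δ₀ (1 / 2) 1
    (unifC d Cp a₀ δ₀) hRm hU hδ₀ (by norm_num) (by norm_num) le_rfl hsmall hqmin hq hre
    (hB1_scaled d ha₀ δ₀ hη) (hB2_scaled d ha₀ δ₀ hη)
    (ballCut_zero_or_one N M₀) (ballCut_eq_one N M₀)
  refine hasMajorant_mono _ hcap ?_
  intro a b
  exact rate_mono_aux hX hSlt

end Chain

end

end Literature.MathematicalPhysics.QuantumFieldTheory.Balaban1983to89.B9Thm37GlueTorusScaled
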